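import Literature.AnabelianGeometry.EtaleTheta.Discharge.Sec4Thm44PsiBsPin
import Literature.AnabelianGeometry.EtaleTheta.BiKummerThm44SubGaloisDescent
import Literature.AnabelianGeometry.EtaleTheta.Discharge.Sec5PushforwardOuterRepSquare
import HarnessLib

/-!
# [EtTh] Thm 4.4 (iii) at the faithful [FrdII] Def 2.2 reading: the `G`/`H`/`E`/`outer` data of the context isomorphism

S. Mochizuki, *The étale theta function …* [MochizukiEtTh2009], Thm 4.4 (iii) p.95 («cf. [FrdII], Definition 2.2, (ii);
[AbsAnab], Lemma 1.3.8»); *The geometry of Frobenioids II* [MochizukiFrdII2008], Def 2.2 (i) p.17, Thm 2.4 (i) p.19.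

abc-iut-w6-d047, T44-L15b E-part §2, THE JOINT: for abc-iut-L2-t4's settings `mkOfConnectedTemperoid`, any
`h : Thm44Hyp`, a Galois-based Frobenius-side object `A″` and `B″ ≅ Ψ(A″)`, and ANY representatives `ρ_A`, `ρ_B` of the
outer homomorphisms `G_{K₁} ↠ Aut(aug₁_* A″^bs)`, `G_{K₂} ↠ Aut(aug₂_* B″^bs)` (the shape of abc-iut-w6-d047's
`exists_pushforwardOuterRep` / `outerRep`), there are — from [AbsAnab] Lem 1.3.8 in ∀-form (`hΔ`) and open augmentations —
`ι : G_{K₁} ⥲ G_{K₂}` (topological) with `ι(H^{bs-fld}_{⊙,1}) = H^{bs-fld}_{⊙,2}`, `E : Aut(aug₁_* A″^bs) ⥲ Aut(aug₂_* B″^bs)`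
and `c ∈ G_{K₂}` with `E(ρ_A x) = ρ_B(c)·ρ_B(ι x)·ρ_B(c)⁻¹`; and `B″^bs` is Galois.  These are the fields `isoG`, `map_H`,
`isoE`, `outer_isoG`, `isGalois_iff` of a [FrdII] Def 2.2 context isomorphism `ctx₁ A″ ⥲ (ctx₂ B″).conjOuter c`
(abc-iut-w6-d047's `preservesNHSaturatedBsFld_of_def22Iso_conjOuter`); the remaining fields `isoC`/`isoO`/`res_isoC`
are `Ψ` on `Aut`/`O^×` ([FrdI] Thm 3.4 (v), `Thm44Hyp.autIso` / `units_map`) and `isoO_smul` is the Ψ-equivariance of the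
descended actions (a datum-level law).  Ingredients, all THEOREMS of the tree: the Ψ^bs pin (`exists_pin_…`, [SemiAnbd]
Prop 3.2), the descent `G_{K₁} ⥲ G_{K₂}` (`exists_galoisContinuousEquiv_map_hodotBsFld`), the push-forward square and
its `Aut` transport (`exists_orbitsSquareIso`, `exists_squareAutEquiv`), the outer representatives along the square
(`exists_outerRep_square`).  Proof-only.
-/

namespace Literature.AnabelianGeometry.EtaleTheta

open CategoryTheory Opposite Literature.AlgebraicGeometry.Frobenioids Literature.AlgebraicGeometry.Frobenioids.QuasiTemperoid
  Literature.AnabelianGeometry.SemiGraphs Literature.AnabelianGeometry.SemiGraphs.GaloisObjects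
  Literature.AnabelianGeometry.EtaleTheta.CnstPushforward

/-! ### A bookkeeping lemma on `Aut` -/

/-- A natural isomorphism `N : F ≅ G` conjugates `G` on automorphisms back into `F`: `N_X ∘ G(τ) ∘ N_X⁻¹ = F(τ)`.
[folklore] -/
private theorem natIso_app_symm_conjAut_mapAut {C : Type*} [Category C] {D : Type*} [Category D] {F G : C ⥤ D} (N : F ≅ G)
    (X : C) (τ : Aut X) : (N.app X).symm.conjAut (G.mapAut X τ) = F.mapAut X τ := by
  apply Iso.ext
  rw [Iso.conjAut_hom, Iso.conj_apply, Iso.symm_inv, Iso.symm_hom, Iso.app_inv, Iso.app_hom]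
  change N.hom.app X ≫ G.map τ.hom ≫ N.inv.app X = F.map τ.hom
  rw [N.inv.naturality, Iso.hom_inv_id_app_assoc]

namespace BiKummerSetting

universe u₀ v₀ w

variable {K : Type u₀} [Field K] {K' : Type u₀} [Field K'] {X₁ : SemiGraphs.TemperedArithmeticGroup.{u₀} K}
  {X₂ : SemiGraphs.TemperedArithmeticGroup.{u₀} K'} {D₀ : Type u₀} [Category.{v₀} D₀] {D₀' : Type u₀}
  [Category.{v₀} D₀'] {V : FrdIMonoidStub.{w}} {T₁ : RealifiedDivisorMonoids (D₀ := D₀) V}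
  {T₂ : RealifiedDivisorMonoids (D₀ := D₀') V}
  {VD₁ : FrdICatStub.{u₀ + 1, u₀, w} (ConnectedPart (BTemp X₁.Pi))}
  {VD₂ : FrdICatStub.{u₀ + 1, u₀, w} (ConnectedPart (BTemp X₂.Pi))}
  {tf₁ : TemperedFrobenioid T₁ (ConnectedPart (BTemp X₁.Pi)) VD₁} {hZ₁ : tf₁.monoidType = MonoidType.Z}
  {hP₁ : ∀ A : (ConnectedPart (BTemp X₁.Pi))ᵒᵖ, IsPerfect (tf₁.Φ.carrier A)}
  {NH₁ : Subgroup (Field.absoluteGaloisGroup K) → tf₁.category → ℕ+ → Prop} {A₁ : tf₁.category}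
  {hA₁ : PreFrobenioid.IsFrobeniusTrivial tf₁.toElem A₁} {hA₁' : SemiGraphs.IsGaloisObj A₁.base.obj}
  {tf₂ : TemperedFrobenioid T₂ (ConnectedPart (BTemp X₂.Pi)) VD₂} {hZ₂ : tf₂.monoidType = MonoidType.Z}
  {hP₂ : ∀ B : (ConnectedPart (BTemp X₂.Pi))ᵒᵖ, IsPerfect (tf₂.Φ.carrier B)}
  {NH₂ : Subgroup (Field.absoluteGaloisGroup K') → tf₂.category → ℕ+ → Prop} {A₂ : tf₂.category}
  {hA₂ : PreFrobenioid.IsFrobeniusTrivial tf₂.toElem A₂} {hA₂' : SemiGraphs.IsGaloisObj A₂.base.obj}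

/-- **The `G`/`H`/`E`/`outer` data of the [FrdII] Def 2.2 context isomorphism induced by `Ψ`, at the genuine connected
base** (fields `isoG`, `map_H`, `isoE`, `outer_isoG` — up to the inner automorphism `c` — and `isGalois_iff` of
`ctx₁ A″ ⥲ (ctx₂ B″).conjOuter c`), for ANY representatives `ρ_A`, `ρ_B` of the two outer homomorphisms: from [AbsAnab]
Lem 1.3.8 in ∀-form (`hΔ`) and open augmentations (`haug₁`, `haug₂`) only. [cite: MochizukiEtTh2009, Thm 4.4 (iii) p.95] -/
theorem Thm44Hyp.exists_def22OuterData_mkOfConnectedTemperoid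
    (h : Thm44Hyp (mkOfConnectedTemperoid X₁ tf₁ hZ₁ hP₁ NH₁ A₁ hA₁ hA₁')
      (mkOfConnectedTemperoid X₂ tf₂ hZ₂ hP₂ NH₂ A₂ hA₂ hA₂'))
    (hΔ : ∀ θ : X₁.Pi ≃ₜ* X₂.Pi, X₁.delta.map θ.toMulEquiv.toMonoidHom = X₂.delta)
    (haug₁ : IsOpenMap X₁.aug) (haug₂ : IsOpenMap X₂.aug)
    (A'' : tf₁.category) (hA : SemiGraphs.IsGaloisObj A''.base.obj) (B'' : tf₂.category) (e : h.Ψ.functor.obj A'' ≅ B'')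
    {ρA : Field.absoluteGaloisGroup K →*
      Aut ((pushforward X₁.aug.toMonoidHom X₁.aug_surjective haug₁).obj A''.base)}
    (hρA : ∀ g : X₁.Pi, ρA (X₁.aug g) = (pushforward X₁.aug.toMonoidHom X₁.aug_surjective haug₁).mapAut A''.base
      (((connectedObjects (BTemp X₁.Pi)).fullyFaithfulι.autMulEquivOfFullyFaithful A''.base).symm
        (galoisSurjOf X₁.isTempered A''.base.obj hA g)))
    {ρB : Field.absoluteGaloisGroup K' →*
      Aut ((pushforward X₂.aug.toMonoidHom X₂.aug_surjective haug₂).obj B''.base)}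
    (hρB : ∀ (hB : SemiGraphs.IsGaloisObj B''.base.obj) (g : X₂.Pi),
      ρB (X₂.aug g) = (pushforward X₂.aug.toMonoidHom X₂.aug_surjective haug₂).mapAut B''.base
        (((connectedObjects (BTemp X₂.Pi)).fullyFaithfulι.autMulEquivOfFullyFaithful B''.base).symm
          (galoisSurjOf X₂.isTempered B''.base.obj hB g))) :
    SemiGraphs.IsGaloisObj B''.base.obj ∧
      ∃ (ι : Field.absoluteGaloisGroup K ≃ₜ* Field.absoluteGaloisGroup K')
        (E : Aut ((pushforward X₁.aug.toMonoidHom X₁.aug_surjective haug₁).obj A''.base) ≃*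
          Aut ((pushforward X₂.aug.toMonoidHom X₂.aug_surjective haug₂).obj B''.base))
        (c : Field.absoluteGaloisGroup K'),
        (mkOfConnectedTemperoid X₁ tf₁ hZ₁ hP₁ NH₁ A₁ hA₁ hA₁').HodotBsFld.map ι.toMulEquiv.toMonoidHom =
            (mkOfConnectedTemperoid X₂ tf₂ hZ₂ hP₂ NH₂ A₂ hA₂ hA₂').HodotBsFld ∧
          ∀ x : Field.absoluteGaloisGroup K, E (ρA x) = ρB c * ρB (ι x) * (ρB c)⁻¹ := by
  -- the pin `Ψ^bs ⋙ ι ≅ ι ⋙ B^temp(θ⁻¹)` together with `θ(H_{⊙,1}) = H_{⊙,2}`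
  obtain ⟨θ, hθH, ⟨η⟩⟩ := h.exists_pin_mkOfConnectedTemperoid
  -- the descent `ι : G_{K₁} ⥲ G_{K₂}` over `θ`, carrying `H^{bs-fld}_{⊙,1}` onto `H^{bs-fld}_{⊙,2}`
  obtain ⟨ι, hι, hιH⟩ := exists_galoisContinuousEquiv_map_hodotBsFld
    (mkOfConnectedTemperoid X₁ tf₁ hZ₁ hP₁ NH₁ A₁ hA₁ hA₁') (mkOfConnectedTemperoid X₂ tf₂ hZ₂ hP₂ NH₂ A₂ hA₂ hA₂')
    θ hθH (hΔ θ) haug₁ haug₂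
  -- `β : B″^bs ≅ B^temp(θ⁻¹)(A″^bs)` from `e`, `Base ∘ Ψ ≅ Ψ^bs ∘ Base` and the pin
  let β : B''.base.obj ≅ (BTemp.res (θ.symm : X₂.Pi →ₜ* X₁.Pi)).obj A''.base.obj :=
    (connectedObjects (BTemp X₂.Pi)).ι.mapIso (tf₂.baseFunctorOfCategory.mapIso e.symm ≪≫ (h.cmp A'').symm) ≪≫
      η.app A''.base
  have hθs : Function.Surjective (θ.symm : X₂.Pi →ₜ* X₁.Pi) := fun g => ⟨θ g, θ.symm_apply_apply g⟩
  have hB : SemiGraphs.IsGaloisObj B''.base.obj :=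
    isGaloisObj_of_iso X₂.isTempered β (isGaloisObj_res X₁.isTempered _ hθs _ hA)
  -- the push-forward square `ι ∘ aug₁ = aug₂ ∘ θ`, its `Aut` transport, and the outer representatives along it
  have hsq : ∀ g : X₁.Pi, ι (X₁.aug.toMonoidHom g) = X₂.aug.toMonoidHom (θ g) := hι
  obtain ⟨J, hJ⟩ := exists_orbitsSquareIso X₁.aug.toMonoidHom X₁.aug_surjective haug₁ X₂.aug.toMonoidHom
    X₂.aug_surjective haug₂ θ ι hsq
  obtain ⟨E, hE⟩ := exists_squareAutEquiv X₁.aug.toMonoidHom X₁.aug_surjective haug₁ X₂.aug.toMonoidHom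
    X₂.aug_surjective haug₂ θ ι J hJ A''.base B''.base β
  obtain ⟨c, hc⟩ := exists_outerRep_square X₁.aug.toMonoidHom X₁.aug_surjective haug₁ X₂.aug.toMonoidHom
    X₂.aug_surjective haug₂ θ ι hsq X₁.isTempered X₂.isTempered A''.base hA B''.base hB β hρA (hρB hB) hE
  exact ⟨hB, ι, E, c, hιH, hc⟩

/-- **The same data TOGETHER WITH the `res_isoC` law** for `isoC := e⁻¹ ∘ Ψ(−) ∘ e` (`Thm44Hyp.autIso` followed by
conjugation along `e : Ψ A″ ≅ B″`): the transport `E` satisfies `E(res₁ α) = res₂(e⁻¹ Ψ(α) e)` for every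
`α ∈ Aut_{C₁}(A″)`, where `res_i = aug_{i,*} ∘ Base_i` on `Aut` — naturality of `Base ∘ Ψ ≅ Ψ^bs ∘ Base` (`Thm44Hyp.cmp`)
and of the pin `Ψ^bs ⋙ ι ≅ ι ⋙ B^temp(θ⁻¹)`.  Fields `isoG`, `map_H`, `isoE`, `outer_isoG`, `isGalois_iff` AND `res_isoC`
of the context isomorphism are thus theorems. [cite: MochizukiEtTh2009, Thm 4.4 (iii) p.95] -/
theorem Thm44Hyp.exists_def22OuterData_res_mkOfConnectedTemperoid
    (h : Thm44Hyp (mkOfConnectedTemperoid X₁ tf₁ hZ₁ hP₁ NH₁ A₁ hA₁ hA₁')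
      (mkOfConnectedTemperoid X₂ tf₂ hZ₂ hP₂ NH₂ A₂ hA₂ hA₂'))
    (hΔ : ∀ θ : X₁.Pi ≃ₜ* X₂.Pi, X₁.delta.map θ.toMulEquiv.toMonoidHom = X₂.delta)
    (haug₁ : IsOpenMap X₁.aug) (haug₂ : IsOpenMap X₂.aug)
    (A'' : tf₁.category) (hA : SemiGraphs.IsGaloisObj A''.base.obj) (B'' : tf₂.category) (e : h.Ψ.functor.obj A'' ≅ B'')
    {ρA : Field.absoluteGaloisGroup K →*
      Aut ((pushforward X₁.aug.toMonoidHom X₁.aug_surjective haug₁).obj A''.base)}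
    (hρA : ∀ g : X₁.Pi, ρA (X₁.aug g) = (pushforward X₁.aug.toMonoidHom X₁.aug_surjective haug₁).mapAut A''.base
      (((connectedObjects (BTemp X₁.Pi)).fullyFaithfulι.autMulEquivOfFullyFaithful A''.base).symm
        (galoisSurjOf X₁.isTempered A''.base.obj hA g)))
    {ρB : Field.absoluteGaloisGroup K' →*
      Aut ((pushforward X₂.aug.toMonoidHom X₂.aug_surjective haug₂).obj B''.base)}
    (hρB : ∀ (hB : SemiGraphs.IsGaloisObj B''.base.obj) (g : X₂.Pi),
      ρB (X₂.aug g) = (pushforward X₂.aug.toMonoidHom X₂.aug_surjective haug₂).mapAut B''.base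
        (((connectedObjects (BTemp X₂.Pi)).fullyFaithfulι.autMulEquivOfFullyFaithful B''.base).symm
          (galoisSurjOf X₂.isTempered B''.base.obj hB g))) :
    SemiGraphs.IsGaloisObj B''.base.obj ∧
      ∃ (ι : Field.absoluteGaloisGroup K ≃ₜ* Field.absoluteGaloisGroup K')
        (E : Aut ((pushforward X₁.aug.toMonoidHom X₁.aug_surjective haug₁).obj A''.base) ≃*
          Aut ((pushforward X₂.aug.toMonoidHom X₂.aug_surjective haug₂).obj B''.base))
        (c : Field.absoluteGaloisGroup K'),
        (mkOfConnectedTemperoid X₁ tf₁ hZ₁ hP₁ NH₁ A₁ hA₁ hA₁').HodotBsFld.map ι.toMulEquiv.toMonoidHom =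
            (mkOfConnectedTemperoid X₂ tf₂ hZ₂ hP₂ NH₂ A₂ hA₂ hA₂').HodotBsFld ∧
          (∀ x : Field.absoluteGaloisGroup K, E (ρA x) = ρB c * ρB (ι x) * (ρB c)⁻¹) ∧
          ∀ α : Aut A'', E ((pushforward X₁.aug.toMonoidHom X₁.aug_surjective haug₁).mapAut A''.base
              (tf₁.baseFunctorOfCategory.mapAut A'' α)) =
            (pushforward X₂.aug.toMonoidHom X₂.aug_surjective haug₂).mapAut B''.base
              (tf₂.baseFunctorOfCategory.mapAut B'' (e.conjAut (h.Ψ.functor.mapAut A'' α))) := by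
  obtain ⟨θ, hθH, ⟨η⟩⟩ := h.exists_pin_mkOfConnectedTemperoid
  obtain ⟨ι, hι, hιH⟩ := exists_galoisContinuousEquiv_map_hodotBsFld
    (mkOfConnectedTemperoid X₁ tf₁ hZ₁ hP₁ NH₁ A₁ hA₁ hA₁') (mkOfConnectedTemperoid X₂ tf₂ hZ₂ hP₂ NH₂ A₂ hA₂ hA₂')
    θ hθH (hΔ θ) haug₁ haug₂
  -- `β : B″^bs ≅ B^temp(θ⁻¹)(A″^bs)`, through `γ : B″^bs ≅ Ψ^bs(A″^bs)` in `B^temp(Π^tp_{X₂})⁰`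
  let γ : B''.base ≅ h.Ψbs.functor.obj A''.base := tf₂.baseFunctorOfCategory.mapIso e.symm ≪≫ (h.cmp A'').symm
  let β : B''.base.obj ≅ (BTemp.res (θ.symm : X₂.Pi →ₜ* X₁.Pi)).obj A''.base.obj :=
    (connectedObjects (BTemp X₂.Pi)).ι.mapIso γ ≪≫ η.app A''.base
  have hθs : Function.Surjective (θ.symm : X₂.Pi →ₜ* X₁.Pi) := fun g => ⟨θ g, θ.symm_apply_apply g⟩
  have hB : SemiGraphs.IsGaloisObj B''.base.obj :=
    isGaloisObj_of_iso X₂.isTempered β (isGaloisObj_res X₁.isTempered _ hθs _ hA)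
  have hsq : ∀ g : X₁.Pi, ι (X₁.aug.toMonoidHom g) = X₂.aug.toMonoidHom (θ g) := hι
  obtain ⟨J, hJ⟩ := exists_orbitsSquareIso X₁.aug.toMonoidHom X₁.aug_surjective haug₁ X₂.aug.toMonoidHom
    X₂.aug_surjective haug₂ θ ι hsq
  obtain ⟨E, hE⟩ := exists_squareAutEquiv X₁.aug.toMonoidHom X₁.aug_surjective haug₁ X₂.aug.toMonoidHom
    X₂.aug_surjective haug₂ θ ι J hJ A''.base B''.base β
  obtain ⟨c, hc⟩ := exists_outerRep_square X₁.aug.toMonoidHom X₁.aug_surjective haug₁ X₂.aug.toMonoidHom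
    X₂.aug_surjective haug₂ θ ι hsq X₁.isTempered X₂.isTempered A''.base hA B''.base hB β hρA (hρB hB) hE
  refine ⟨hB, ι, E, c, hιH, hc, fun α => ?_⟩
  rw [hE]
  refine congrArg ((pushforward X₂.aug.toMonoidHom X₂.aug_surjective haug₂).mapAut B''.base) ?_
  rw [MulEquiv.symm_apply_eq]
  -- both sides in `Aut_{B^temp(Π^tp_{X₂})}(B″^bs)`; write `σ₁ := Base₁(α)`
  -- (1) the transports through the fully faithful inclusions are `mapIso`
  have hιA : ∀ τ : Aut A''.base, ((connectedObjects (BTemp X₁.Pi)).fullyFaithfulι.autMulEquivOfFullyFaithful A''.base) τ =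
      (connectedObjects (BTemp X₁.Pi)).ι.mapAut A''.base τ := fun _ => rfl
  have hιB : ∀ τ : Aut B''.base, ((connectedObjects (BTemp X₂.Pi)).fullyFaithfulι.autMulEquivOfFullyFaithful B''.base) τ =
      (connectedObjects (BTemp X₂.Pi)).ι.mapIso τ := fun _ => rfl
  -- (2) `Base₂(e⁻¹ Ψ(α) e) = (Base₂ e)⁻¹-conjugate of `c_A⁻¹ Ψ^bs(Base₁ α) c_A`
  have hbase : tf₂.baseFunctorOfCategory.mapAut B'' (e.conjAut (h.Ψ.functor.mapAut A'' α)) =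
      γ.symm.conjAut (h.Ψbs.functor.mapAut A''.base (tf₁.baseFunctorOfCategory.mapAut A'' α)) := by
    have h1 : tf₂.baseFunctorOfCategory.mapAut B'' (e.conjAut (h.Ψ.functor.mapAut A'' α)) =
        (tf₂.baseFunctorOfCategory.mapIso e).conjAut
          (tf₂.baseFunctorOfCategory.mapAut _ (h.Ψ.functor.mapAut A'' α)) :=
      tf₂.baseFunctorOfCategory.map_conjAut e _
    have h2 : tf₂.baseFunctorOfCategory.mapAut _ (h.Ψ.functor.mapAut A'' α) =
        (h.cmp A'').conjAut (h.Ψbs.functor.mapAut A''.base (tf₁.baseFunctorOfCategory.mapAut A'' α)) := by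
      have h3 := h.autBase_mapAut A'' α
      exact h3.trans (Iso.ext rfl)
    rw [h1, h2]
    apply Iso.ext
    simp only [γ, Iso.conjAut_hom, Iso.conj_apply, Iso.trans_inv, Iso.trans_hom, Iso.symm_inv, Iso.symm_hom,
      Functor.mapIso_inv, Functor.mapIso_hom, Category.assoc]
    -- reassociate across `(Ψ A″)^bs = Base₂(Ψ A″)` (definitional, not syntactic)
    erw [Category.assoc, Category.assoc]
    rfl
  -- (3) assemble: `β⁻¹`-conjugation = `(ι γ)⁻¹`-conjugation after `η_A⁻¹`-conjugation, and `η⁻¹` is natural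
  rw [hιB, hbase, Functor.map_conjAut, Functor.mapIso_symm, hιA]
  change ((connectedObjects (BTemp X₂.Pi)).ι.mapIso γ ≪≫ η.app A''.base).symm.conjAut
      (((connectedObjects (BTemp X₁.Pi)).ι ⋙ BTemp.res (θ.symm : X₂.Pi →ₜ* X₁.Pi)).mapAut A''.base
        (tf₁.baseFunctorOfCategory.mapAut A'' α)) = _
  have hnat := natIso_app_symm_conjAut_mapAut η A''.base (tf₁.baseFunctorOfCategory.mapAut A'' α)
  rw [Iso.trans_symm, Iso.trans_conjAut]
  erw [hnat]
  rfl

end BiKummerSetting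

end Literature.AnabelianGeometry.EtaleTheta

/-! ## v2 (append-only): `Ψ` preserves AND REFLECTS «`(−)^bs` is Galois» along `B″ ≅ Ψ A″` (field `isGalois_iff`) -/

namespace Literature.AnabelianGeometry.EtaleTheta

open CategoryTheory Opposite Literature.AlgebraicGeometry.Frobenioids Literature.AlgebraicGeometry.Frobenioids.QuasiTemperoid
  Literature.AnabelianGeometry.SemiGraphs Literature.AnabelianGeometry.SemiGraphs.GaloisObjects

namespace BiKummerSetting

universe u₀' v₀' w'

variable {K : Type u₀'} [Field K] {K' : Type u₀'} [Field K'] {X₁ : SemiGraphs.TemperedArithmeticGroup.{u₀'} K}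
  {X₂ : SemiGraphs.TemperedArithmeticGroup.{u₀'} K'} {D₀ : Type u₀'} [Category.{v₀'} D₀] {D₀' : Type u₀'}
  [Category.{v₀'} D₀'] {V : FrdIMonoidStub.{w'}} {T₁ : RealifiedDivisorMonoids (D₀ := D₀) V}
  {T₂ : RealifiedDivisorMonoids (D₀ := D₀') V}
  {VD₁ : FrdICatStub.{u₀' + 1, u₀', w'} (ConnectedPart (BTemp X₁.Pi))}
  {VD₂ : FrdICatStub.{u₀' + 1, u₀', w'} (ConnectedPart (BTemp X₂.Pi))}
  {tf₁ : TemperedFrobenioid T₁ (ConnectedPart (BTemp X₁.Pi)) VD₁} {hZ₁ : tf₁.monoidType = MonoidType.Z}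
  {hP₁ : ∀ A : (ConnectedPart (BTemp X₁.Pi))ᵒᵖ, IsPerfect (tf₁.Φ.carrier A)}
  {NH₁ : Subgroup (Field.absoluteGaloisGroup K) → tf₁.category → ℕ+ → Prop} {A₁ : tf₁.category}
  {hA₁ : PreFrobenioid.IsFrobeniusTrivial tf₁.toElem A₁} {hA₁' : SemiGraphs.IsGaloisObj A₁.base.obj}
  {tf₂ : TemperedFrobenioid T₂ (ConnectedPart (BTemp X₂.Pi)) VD₂} {hZ₂ : tf₂.monoidType = MonoidType.Z}
  {hP₂ : ∀ B : (ConnectedPart (BTemp X₂.Pi))ᵒᵖ, IsPerfect (tf₂.Φ.carrier B)}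
  {NH₂ : Subgroup (Field.absoluteGaloisGroup K') → tf₂.category → ℕ+ → Prop} {A₂ : tf₂.category}
  {hA₂ : PreFrobenioid.IsFrobeniusTrivial tf₂.toElem A₂} {hA₂' : SemiGraphs.IsGaloisObj A₂.base.obj}

/-- **`A″^bs` is Galois iff `B″^bs` is, for `e : Ψ A″ ≅ B″`** (field `isGalois_iff` of the context isomorphism, BOTH
directions, no hypothesis beyond `Thm44Hyp`): `B″^bs ≅ B^temp(θ⁻¹)(A″^bs)` by the pin, and `B^temp` of an isomorphism of
groups preserves and reflects Galois objects. [cite: MochizukiEtTh2009, Thm 4.4 (iii) p.95] -/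
theorem Thm44Hyp.isGaloisObj_base_iff_mkOfConnectedTemperoid
    (h : Thm44Hyp (mkOfConnectedTemperoid X₁ tf₁ hZ₁ hP₁ NH₁ A₁ hA₁ hA₁')
      (mkOfConnectedTemperoid X₂ tf₂ hZ₂ hP₂ NH₂ A₂ hA₂ hA₂'))
    (A'' : tf₁.category) (B'' : tf₂.category) (e : h.Ψ.functor.obj A'' ≅ B'') :
    SemiGraphs.IsGaloisObj A''.base.obj ↔ SemiGraphs.IsGaloisObj B''.base.obj := by
  obtain ⟨θ, -, ⟨η⟩⟩ := h.exists_pin_mkOfConnectedTemperoid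
  let β : B''.base.obj ≅ (BTemp.res (θ.symm : X₂.Pi →ₜ* X₁.Pi)).obj A''.base.obj :=
    (connectedObjects (BTemp X₂.Pi)).ι.mapIso (tf₂.baseFunctorOfCategory.mapIso e.symm ≪≫ (h.cmp A'').symm) ≪≫
      η.app A''.base
  have hθs : Function.Surjective (θ.symm : X₂.Pi →ₜ* X₁.Pi) := fun g => ⟨θ g, θ.symm_apply_apply g⟩
  have hθs' : Function.Surjective (θ : X₁.Pi →ₜ* X₂.Pi) := fun g => ⟨θ.symm g, θ.apply_symm_apply g⟩
  constructor
  · intro hA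
    exact isGaloisObj_of_iso X₂.isTempered β (isGaloisObj_res X₁.isTempered _ hθs _ hA)
  · intro hB
    -- `A″^bs ≅ B^temp(θ)(B^temp(θ⁻¹)(A″^bs))`, and `B^temp(θ⁻¹)(A″^bs) ≅ B″^bs` is Galois
    have h1 : SemiGraphs.IsGaloisObj ((BTemp.res (θ.symm : X₂.Pi →ₜ* X₁.Pi)).obj A''.base.obj) :=
      isGaloisObj_of_iso X₂.isTempered β.symm hB
    exact isGaloisObj_of_iso X₁.isTempered
      (BTemp.resResIso (θ.symm : X₂.Pi →ₜ* X₁.Pi) (θ : X₁.Pi →ₜ* X₂.Pi) (fun x => θ.symm_apply_apply x) A''.base.obj)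
      (isGaloisObj_res X₂.isTempered _ hθs' _ h1)

end BiKummerSetting

end Literature.AnabelianGeometry.EtaleTheta
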